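import Mathlib.Topology.MetricSpace.Pseudo.Pi
import Summits.KontsevichZagierPeriods.KontsevichZagierPeriods.Theorems.SoloInformedTameMapDiff
import HarnessLib

/-!
# Tame dissections up to sets of empty interior — the first-order clauses

Files `SoloInformedTameMapFamilies` … `SoloInformedTameMapCircleSquaring` treat EXACT dissections:
the pieces partition the source and their images partition the box. Classical dissections
("scissors congruences", Tarski's circle squaring) allow the pieces to OVERLAP and to MISS parts of
the source and of the target along sets of empty interior (boundaries). This file writes that slack
as first-order conditions on the real parameter `p` of a nonlinear tame shape
`σ : SoloInformedTameMapShape K n N`: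

* `soloInformedThin T p` — the **thin-fibre clause**: every nondegenerate open coordinate box of
  `ℝⁿ` contains a point `y` with `(p, y) ∉ T`; it is `ℚ`-semialgebraic in `p` for a
  `ℚ`-semialgebraic family `T ⊆ ℝ^{K ⊕ n}` (two quantifier blocks, two Tarski–Seidenberg
  projections) and it says exactly `interior {y | (p, y) ∈ T} = ∅`
  (`soloInformed_thin_iff_interior_eq_empty`);
* the image families `σ.imgFam i ⊆ ℝ^{K ⊕ n}` (`(p, y)` with `y` in the image of piece `i`), the
  rest families `σ.restFam D₀` (points of `D₀` in no piece) and `σ.imgRestFam` (points of the box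
  in no image), the subset matrix `σ.subSet D₀ i`;
* the fibres of these families at a parameter `p` (`setOf_sumElim_mem_*`): intersections of
  pieces, the uncovered part `D₀ \ ⋃ pieces`, intersections of images `σ.img i p`, the uncovered
  part of the box.

Slack validity (`SoloInformedTameMapSlackValid`), soundness and the headline are in the sequels.

References: [cite: BochnakCosteRoy1998, §2.2, Prop. 2.2.4]; Tarski (1951).
-/

noncomputable section

open Set MvPolynomial Literature.ModelTheory.ExponentialFields

namespace Summit.KontsevichZagierPeriods.KontsevichZagierPeriods.Theorems

/-! ### Two more building blocks -/

/-- Coordinate atom `w a < w b`. [folklore] -/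
theorem soloInformed_isSemialgebraic_setOf_coord_lt {ι : Type*} (a b : ι) :
    IsSemialgebraic ℚ {w : ι → ℝ | w a < w b} := by
  have hset : {w : ι → ℝ | w a < w b} =
      {w | aeval w (X a : MvPolynomial ι ℚ) < aeval w (X b : MvPolynomial ι ℚ)} := by
    ext w
    simp only [mem_setOf_eq, aeval_X]
  rw [hset]
  exact isSemialgebraic_setOf_eval_lt _ _

/-- Disjunction of `ℚ`-semialgebraic conditions. [folklore] -/
theorem soloInformed_isSemialgebraic_setOf_or {ι : Type*} {P Q : (ι → ℝ) → Prop}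
    (hP : IsSemialgebraic ℚ {w | P w}) (hQ : IsSemialgebraic ℚ {w | Q w}) :
    IsSemialgebraic ℚ {w : ι → ℝ | P w ∨ Q w} := by
  rw [setOf_or]
  exact hP.union hQ

/-! ### The thin-fibre clause -/

section Thin

variable {K : Type*} {n : ℕ}

/-- Inner matrix of the thin-fibre clause, in `((p, (a, b)), y)`: `y` lies in the open box with
corners `a < b` and `(p, y) ∉ T`. [folklore] -/
def soloInformedThinInner (T : Set (K ⊕ Fin n → ℝ)) :
    Set ((K ⊕ (Fin n ⊕ Fin n)) ⊕ Fin n → ℝ) :=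
  {w | (∀ k, w (Sum.inl (Sum.inr (Sum.inl k))) < w (Sum.inr k) ∧
      w (Sum.inr k) < w (Sum.inl (Sum.inr (Sum.inr k)))) ∧
    w ∘ Sum.elim (Sum.inl ∘ Sum.inl) Sum.inr ∉ T}

/-- Outer matrix of the thin-fibre clause, in `(p, (a, b))`: if `a < b` coordinatewise then some
`y` of the open box `(a, b)` has `(p, y) ∉ T`. [folklore] -/
def soloInformedThinOuter (T : Set (K ⊕ Fin n → ℝ)) : Set (K ⊕ (Fin n ⊕ Fin n) → ℝ) :=
  {u | (∀ k, u (Sum.inr (Sum.inl k)) < u (Sum.inr (Sum.inr k))) →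
    ∃ y : Fin n → ℝ, Sum.elim u y ∈ soloInformedThinInner T}

/-- **The thin-fibre clause**: every nondegenerate open coordinate box of `ℝⁿ` contains a point
`y` with `(p, y) ∉ T`. [folklore] -/
def soloInformedThin (T : Set (K ⊕ Fin n → ℝ)) (p : K → ℝ) : Prop :=
  ∀ z : Fin n ⊕ Fin n → ℝ, Sum.elim p z ∈ soloInformedThinOuter T

variable {T : Set (K ⊕ Fin n → ℝ)}

/-- The inner matrix is `ℚ`-semialgebraic. [cite: BochnakCosteRoy1998, §2.2] -/
theorem soloInformed_isSemialgebraic_thinInner (hT : IsSemialgebraic ℚ T) :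
    IsSemialgebraic ℚ (soloInformedThinInner T) :=
  soloInformed_isSemialgebraic_setOf_and
    (soloInformed_isSemialgebraic_setOf_forall fun _ =>
      soloInformed_isSemialgebraic_setOf_and (soloInformed_isSemialgebraic_setOf_coord_lt _ _)
        (soloInformed_isSemialgebraic_setOf_coord_lt _ _))
    (soloInformed_isSemialgebraic_setOf_not (hT.preimage_comp _))

/-- The outer matrix is `ℚ`-semialgebraic (one projection). [cite: BochnakCosteRoy1998, §2.2] -/
theorem soloInformed_isSemialgebraic_thinOuter [Finite K] (hT : IsSemialgebraic ℚ T) :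
    IsSemialgebraic ℚ (soloInformedThinOuter T) :=
  soloInformed_isSemialgebraic_setOf_imp
    (soloInformed_isSemialgebraic_setOf_forall fun _ =>
      soloInformed_isSemialgebraic_setOf_coord_lt _ _)
    (soloInformed_isSemialgebraic_setOf_exists_block (soloInformed_isSemialgebraic_thinInner hT)
      fun _ => Iff.rfl)

/-- **The thin-fibre clause is `ℚ`-semialgebraic in the parameter** (two projections).
[cite: BochnakCosteRoy1998, Prop. 2.2.4] -/
theorem soloInformed_isSemialgebraic_setOf_thin [Finite K] (hT : IsSemialgebraic ℚ T) :
    IsSemialgebraic ℚ {p : K → ℝ | soloInformedThin T p} :=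
  soloInformed_isSemialgebraic_setOf_forall_block (soloInformed_isSemialgebraic_thinOuter hT)
    fun _ => Iff.rfl

/-- What the thin-fibre clause says, with the box corners as separate variables. [folklore] -/
theorem soloInformed_thin_iff_forall_box {p : K → ℝ} : soloInformedThin T p ↔
    ∀ a b : Fin n → ℝ, (∀ k, a k < b k) →
      ∃ y : Fin n → ℝ, (∀ k, a k < y k ∧ y k < b k) ∧ Sum.elim p y ∉ T := by
  have h1 : ∀ (z : Fin n ⊕ Fin n → ℝ) (y : Fin n → ℝ), (Sum.elim (Sum.elim p z) y) ∘
      (Sum.elim (Sum.inl ∘ Sum.inl) Sum.inr : K ⊕ Fin n → (K ⊕ (Fin n ⊕ Fin n)) ⊕ Fin n) =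
        Sum.elim p y := by
    intro z y; funext t; rcases t with l | j <;> rfl
  simp only [soloInformedThin, soloInformedThinOuter, soloInformedThinInner, mem_setOf_eq,
    Sum.elim_inl, Sum.elim_inr, h1]
  constructor
  · intro h a b hab
    simpa using h (Sum.elim a b) (by simpa using hab)
  · intro h z hz
    exact h (fun k => z (Sum.inl k)) (fun k => z (Sum.inr k)) hz

/-- **The thin-fibre clause says the fibre has empty interior.** (The sup-metric balls of `ℝⁿ`
are open coordinate boxes.) [folklore] -/
theorem soloInformed_thin_iff_interior_eq_empty {p : K → ℝ} : soloInformedThin T p ↔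
    interior {y : Fin n → ℝ | Sum.elim p y ∈ T} = ∅ := by
  rw [soloInformed_thin_iff_forall_box]
  constructor
  · intro h
    ext x
    refine ⟨fun hx => ?_, fun hx => hx.elim⟩
    rw [mem_interior_iff_mem_nhds, Metric.mem_nhds_iff] at hx
    obtain ⟨r, hr, hball⟩ := hx
    obtain ⟨y, hy, hyT⟩ := h (fun k => x k - r) (fun k => x k + r) (fun k => by linarith)
    refine hyT (hball ?_)
    rw [Metric.mem_ball, dist_pi_lt_iff hr]
    intro k
    rw [Real.dist_eq, abs_sub_lt_iff]
    constructor <;> linarith [(hy k).1, (hy k).2]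
  · intro h a b hab
    by_contra hcon
    have hopen : IsOpen (Set.pi univ fun k => Ioo (a k) (b k)) :=
      isOpen_set_pi finite_univ fun k _ => isOpen_Ioo
    have hsub : (Set.pi univ fun k => Ioo (a k) (b k)) ⊆ {y | Sum.elim p y ∈ T} := by
      intro y hy
      by_contra hyT
      exact hcon ⟨y, fun k => (mem_univ_pi.1 hy) k, hyT⟩
    have hmid : (fun k => (a k + b k) / 2) ∈ interior {y : Fin n → ℝ | Sum.elim p y ∈ T} := by
      refine interior_maximal hsub hopen ?_
      simp only [mem_univ_pi, mem_Ioo]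
      intro k
      constructor <;> linarith [hab k]
    rw [h] at hmid
    exact hmid

end Thin

namespace SoloInformedTameMapShape

variable {K : Type*} {n N : ℕ} (σ : SoloInformedTameMapShape K n N)

/-! ### Images, rests and the subset matrix -/

/-- IMAGE inner matrix in `((p, y), x)`: `x` lies in piece `i` and is related to `y`. [folklore] -/
def imgInner (i : Fin N) : Set ((K ⊕ Fin n) ⊕ Fin n → ℝ) :=
  {w | w ∘ Sum.elim (Sum.inl ∘ Sum.inl) Sum.inr ∈ σ.S i ∧
    w ∘ Sum.elim (Sum.inl ∘ Sum.inl) (Sum.elim Sum.inr (Sum.inl ∘ Sum.inr)) ∈ σ.G i}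

/-- IMAGE family in `(p, y)`: `y` lies in the image of piece `i`. [folklore] -/
def imgFam (i : Fin N) : Set (K ⊕ Fin n → ℝ) :=
  {u | ∃ x : Fin n → ℝ, Sum.elim u x ∈ σ.imgInner i}

/-- The image of piece `i` at parameter `p`, read off the graph. [folklore] -/
def img (i : Fin N) (p : K → ℝ) : Set (Fin n → ℝ) := {y | ∃ x, x ∈ σ.piece i p ∧ σ.rel i p x y}

/-- REST family in `(p, x)`: `x ∈ D₀` lies in no piece. [folklore] -/
def restFam (D₀ : Set (Fin n → ℝ)) : Set (K ⊕ Fin n → ℝ) :=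
  {w | w ∘ Sum.inr ∈ D₀ ∧ ∀ i, w ∉ σ.S i}

/-- IMAGE-REST family in `(p, y)`: `y` lies in the box but in no image. [folklore] -/
def imgRestFam : Set (K ⊕ Fin n → ℝ) :=
  {w | w ∘ Sum.inr ∈ soloInformedTameBox (σ.side (w ∘ Sum.inl)) ∧ ∀ i, w ∉ σ.imgFam i}

/-- SUBSET matrix in `(p, x)`: piece `i` lies inside `D₀`. [folklore] -/
def subSet (D₀ : Set (Fin n → ℝ)) (i : Fin N) : Set (K ⊕ Fin n → ℝ) :=
  {w | w ∈ σ.S i → w ∘ Sum.inr ∈ D₀}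

variable {D₀ : Set (Fin n → ℝ)}

/-- The image inner matrix is `ℚ`-semialgebraic. [cite: BochnakCosteRoy1998, §2.2] -/
theorem isSemialgebraic_imgInner {i : Fin N} (hS : IsSemialgebraic ℚ (σ.S i))
    (hG : IsSemialgebraic ℚ (σ.G i)) : IsSemialgebraic ℚ (σ.imgInner i) :=
  soloInformed_isSemialgebraic_setOf_and (hS.preimage_comp _) (hG.preimage_comp _)

/-- The image family is `ℚ`-semialgebraic (one projection). [cite: BochnakCosteRoy1998, §2.2] -/
theorem isSemialgebraic_imgFam [Finite K] {i : Fin N} (hS : IsSemialgebraic ℚ (σ.S i))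
    (hG : IsSemialgebraic ℚ (σ.G i)) : IsSemialgebraic ℚ (σ.imgFam i) :=
  soloInformed_isSemialgebraic_setOf_exists_block (σ.isSemialgebraic_imgInner hS hG)
    fun _ => Iff.rfl

/-- The rest family is `ℚ`-semialgebraic. [cite: BochnakCosteRoy1998, §2.2] -/
theorem isSemialgebraic_restFam (hS : ∀ i, IsSemialgebraic ℚ (σ.S i))
    (hD₀ : IsSemialgebraic ℚ D₀) : IsSemialgebraic ℚ (σ.restFam D₀) :=
  soloInformed_isSemialgebraic_setOf_and (hD₀.preimage_comp _)
    (soloInformed_isSemialgebraic_setOf_forall fun i =>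
      soloInformed_isSemialgebraic_setOf_not (hS i))

/-- The image-rest family is `ℚ`-semialgebraic. [cite: BochnakCosteRoy1998, §2.2] -/
theorem isSemialgebraic_imgRestFam [Finite K] (hS : ∀ i, IsSemialgebraic ℚ (σ.S i))
    (hG : ∀ i, IsSemialgebraic ℚ (σ.G i)) : IsSemialgebraic ℚ σ.imgRestFam :=
  soloInformed_isSemialgebraic_setOf_and (soloInformed_isSemialgebraic_setOf_comp_mem_box _ _ _)
    (soloInformed_isSemialgebraic_setOf_forall fun i =>
      soloInformed_isSemialgebraic_setOf_not (σ.isSemialgebraic_imgFam (hS i) (hG i)))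

/-- The subset matrix is `ℚ`-semialgebraic. [cite: BochnakCosteRoy1998, §2.2] -/
theorem isSemialgebraic_subSet {i : Fin N} (hS : IsSemialgebraic ℚ (σ.S i))
    (hD₀ : IsSemialgebraic ℚ D₀) : IsSemialgebraic ℚ (σ.subSet D₀ i) :=
  soloInformed_isSemialgebraic_setOf_imp hS (hD₀.preimage_comp _)

/-- What membership of `(p, y)` in the image family says. [folklore] -/
theorem sumElim_mem_imgFam_iff {i : Fin N} {p : K → ℝ} {y : Fin n → ℝ} :
    Sum.elim p y ∈ σ.imgFam i ↔ y ∈ σ.img i p := by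
  have hO1 : ∀ x : Fin n → ℝ, (Sum.elim (Sum.elim p y) x) ∘
      (Sum.elim (Sum.inl ∘ Sum.inl) Sum.inr : K ⊕ Fin n → (K ⊕ Fin n) ⊕ Fin n) = Sum.elim p x := by
    intro x; funext t; rcases t with l | j <;> rfl
  have hO2 : ∀ x : Fin n → ℝ, (Sum.elim (Sum.elim p y) x) ∘
      (Sum.elim (Sum.inl ∘ Sum.inl) (Sum.elim Sum.inr (Sum.inl ∘ Sum.inr)) :
        K ⊕ (Fin n ⊕ Fin n) → (K ⊕ Fin n) ⊕ Fin n) = Sum.elim p (Sum.elim x y) := by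
    intro x; funext t; rcases t with l | j | j <;> rfl
  simp only [imgFam, imgInner, img, piece, rel, mem_setOf_eq, hO1, hO2]

/-- The fibre of the image family at `p` is the image `σ.img i p`. [folklore] -/
theorem setOf_sumElim_mem_imgFam {i : Fin N} {p : K → ℝ} :
    {y | Sum.elim p y ∈ σ.imgFam i} = σ.img i p := by
  ext y
  exact σ.sumElim_mem_imgFam_iff

/-- The fibre of an intersection of image families. [folklore] -/
theorem setOf_sumElim_mem_imgFam_inter {i i' : Fin N} {p : K → ℝ} :
    {y | Sum.elim p y ∈ σ.imgFam i ∩ σ.imgFam i'} = σ.img i p ∩ σ.img i' p := by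
  ext y
  simp only [mem_setOf_eq, mem_inter_iff, sumElim_mem_imgFam_iff]

/-- The fibre of an intersection of piece families. [folklore] -/
theorem setOf_sumElim_mem_S_inter {i i' : Fin N} {p : K → ℝ} :
    {x | Sum.elim p x ∈ σ.S i ∩ σ.S i'} = σ.piece i p ∩ σ.piece i' p := by
  ext x
  simp only [mem_setOf_eq, mem_inter_iff, piece]

/-- The fibre of the rest family is the uncovered part of `D₀`. [folklore] -/
theorem setOf_sumElim_mem_restFam {p : K → ℝ} :
    {x | Sum.elim p x ∈ σ.restFam D₀} = D₀ \ ⋃ i, σ.piece i p := by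
  ext x
  simp only [restFam, piece, mem_setOf_eq, Sum.elim_comp_inr, mem_sdiff, mem_iUnion, not_exists]

/-- The fibre of the image-rest family is the uncovered part of the box. [folklore] -/
theorem setOf_sumElim_mem_imgRestFam {p : K → ℝ} :
    {y | Sum.elim p y ∈ σ.imgRestFam} = soloInformedTameBox (σ.side p) \ ⋃ i, σ.img i p := by
  ext y
  simp only [imgRestFam, mem_setOf_eq, Sum.elim_comp_inr, Sum.elim_comp_inl, mem_sdiff, mem_iUnion,
    not_exists, sumElim_mem_imgFam_iff]

end SoloInformedTameMapShape

end Summit.KontsevichZagierPeriods.KontsevichZagierPeriods.Theorems
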